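import Mathlib
import HarnessLib
import Summits.Ventures.LatticeQCDFlow.Exactness.CabibboMarinariCooling

/-!
# Fixed points of the engine's `SU(N)` Cabibbo–Marinari cooling are stationary points of the Wilson flow

HONEST FRAMING: exact (Metropolis-corrected) sampling algorithms for lattice gauge theory;
figures of merit are autocorrelation/cost numbers at stated couplings and volumes; no
continuum-physics claim.

Venture `LatticeQCDFlow` (cell pub-lqcd), topic `Exactness`, FANOUT row 21 (`su3-base`: the row measures the
topological charge of `SU(3)` fields after two different smoothings — the Wilson FLOW (clover charge at flow time `t`,
`t²E`) and COOLING by Cabibbo–Marinari subgroup hits (`Q_L` after `n_cool = 60` sweeps) — and compares their integer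
roundings).  NEW WORK of the cell over the tree (row 21's `CabibboMarinariCooling.lean`: the hit `cmCool e R g = φ(ŝ⁻¹) g`,
`cmLatCool`; row 9's `CabibboMarinariOverrelax.lean` / `CabibboMarinariQuat.lean`: `cmQuat`, `cmUnit`, the polar form
`quatUnit_smul`; `PairWords.pairOf`; row 16's `Scoring/WilsonStapleSum.plaquetteLoopSum_eq_mul_stapleSum`; the
Literature Wilson flow `QuantumFieldTheory/WilsonFlow`: `suProj`, `wilsonFlowVF`, `wilsonFlow_eq_self_of_wilsonFlowVF_eq_zero`).
Nothing is cited as a fact; no number.  The `SU(N)` counterpart of row 16's `Scoring/SU2CoolingFixedPoints.lean` (which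
lists `SU(N ≥ 3)` as NOT CLAIMED).  Printed counterpart, NAMED ONLY: Bonati–D'Elia, PRD 89 (2014) 105005 (cooling versus
gradient flow).

## What is proved

§1 matrices (`W : M_N(ℂ)`): `suProj_eq_zero_of_pairs` — if `W_ij = conj W_ji` for all `i ≠ j` and all `Im W_ii` are
equal, then `P(W) = 0`.
§2 one link (`g ∈ SU(N)`, staple matrix `R`, frame `e` with coordinate pair `pairOf e = (i, j)`, `W = gR`):
`cmQuat_eq_quatOf` (the block quaternion in entries of `W`); **`cmUnit_eq_one_entries`** — if the hit fixes `g`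
(`ŝ = 1`), then `W_ij = conj W_ji` and `Im W_ii = Im W_jj`; `cmUnit_eq_one_of_cmCool_eq` (`cmCool g = g → ŝ = 1`);
**`suProj_eq_zero_of_cmCool_fixed`** — if the hits of a family of frames whose pairs cover all `i < j` (the engine's
lexicographic scan) all fix `g`, then `P(gR) = 0`.
§3 the lattice (`L ≥ 1`, defining representation): **`wilsonFlowVF_eq_zero_of_cmLatCool_fixed`** and
**`wilsonFlow_eq_self_of_cmLatCool_fixed`** — a configuration fixed by EVERY cooling hit (every link, every frame
of a pair-covering family) is a stationary point of the Wilson flow: `Z(U) = 0` and `V_t(U) = U` for all real `t`; on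
such configurations row 21's flowed and cooled charges trivially agree.

NOT CLAIMED: the converse (a flow-stationary link whose block quaternions are NEGATIVE multiples of `1` is not
cooling-fixed — the hit flips it and lowers the action); convergence of iterated cooling or of the flow; agreement of
the two charges away from common fixed points (measured, not a theorem); floating point.
-/

noncomputable section

namespace Summit.Ventures.LatticeQCDFlow.Exactness

open Matrix ComplexConjugate
open Literature.MathematicalPhysics.QuantumFieldTheory
open scoped Matrix

/-! ## §1 `P(W) = 0` from the pair conditions -/

section Proj

variable {N : ℕ} [NeZero N]

/-- **If `W_ij = conj W_ji` off the diagonal and all `Im W_ii` agree, then `P(W) = 0`.** -/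
theorem suProj_eq_zero_of_pairs (W : Matrix (Fin N) (Fin N) ℂ) (hoff : ∀ i j, i ≠ j → W i j = conj (W j i))
    (hdiag : ∀ i j, (W i i).im = (W j j).im) : suProj W = 0 := by
  obtain ⟨i₀⟩ : Nonempty (Fin N) := inferInstance
  set c : ℝ := (W i₀ i₀).im with hc
  have hdiag' : ∀ k, W k k - conj (W k k) = (2 * c : ℝ) * Complex.I := fun k => by
    rw [Complex.sub_conj, hdiag k i₀]
  have htr : (W - Wᴴ).trace = (N : ℂ) * ((2 * c : ℝ) * Complex.I) := by
    simp only [Matrix.trace, Matrix.diag_apply, Matrix.sub_apply, Matrix.conjTranspose_apply, Complex.star_def,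
      hdiag', Finset.sum_const, Finset.card_univ, Fintype.card_fin, nsmul_eq_mul]
  have hN : (N : ℂ) ≠ 0 := by exact_mod_cast NeZero.ne N
  ext i j
  rw [suProj_def, Matrix.sub_apply, Matrix.smul_apply, Matrix.smul_apply, Matrix.sub_apply,
    Matrix.conjTranspose_apply, Matrix.one_apply, Matrix.zero_apply, htr, Complex.star_def]
  by_cases hij : i = j
  · subst hij
    rw [if_pos rfl, hdiag' i, smul_eq_mul, smul_eq_mul, mul_one]
    field_simp
    ring
  · rw [if_neg hij, smul_zero, sub_zero, hoff i j hij, sub_self, smul_zero]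

end Proj

/-! ## §2 One link: a cooling-fixed link satisfies the pair conditions of its frame -/

section OneLink

variable {N : ℕ} {m : Type*} [Fintype m] [DecidableEq m] (e : Fin N ≃ Fin 2 ⊕ m) (R : Matrix (Fin N) (Fin N) ℂ)

omit [Fintype m] [DecidableEq m] in
/-- The block quaternion of `W = gR` in the frame `e`, in entries: with `(i, j) = pairOf e`,
`Q(g) = quatOf (W_ii + conj W_jj) (W_ij − conj W_ji)`. -/
theorem cmQuat_eq_quatOf (g : Matrix.specialUnitaryGroup (Fin N) ℂ) :
    cmQuat e R g = quatOf
      (((g : Matrix (Fin N) (Fin N) ℂ) * R) (pairOf e).1 (pairOf e).1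
        + conj (((g : Matrix (Fin N) (Fin N) ℂ) * R) (pairOf e).2 (pairOf e).2))
      (((g : Matrix (Fin N) (Fin N) ℂ) * R) (pairOf e).1 (pairOf e).2
        - conj (((g : Matrix (Fin N) (Fin N) ℂ) * R) (pairOf e).2 (pairOf e).1)) := by
  rfl

omit [Fintype m] [DecidableEq m] in
/-- **A cooling-fixed link satisfies the pair conditions**: if `ŝ(g) = 1` then, with `(i, j) = pairOf e` and
`W = gR`, `W_ij = conj W_ji` and `Im W_ii = Im W_jj`. -/
theorem cmUnit_eq_one_entries {g : Matrix.specialUnitaryGroup (Fin N) ℂ} (h : cmUnit e R g = 1) :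
    ((g : Matrix (Fin N) (Fin N) ℂ) * R) (pairOf e).1 (pairOf e).2
        = conj (((g : Matrix (Fin N) (Fin N) ℂ) * R) (pairOf e).2 (pairOf e).1) ∧
      (((g : Matrix (Fin N) (Fin N) ℂ) * R) (pairOf e).1 (pairOf e).1).im
        = (((g : Matrix (Fin N) (Fin N) ℂ) * R) (pairOf e).2 (pairOf e).2).im := by
  set W := (g : Matrix (Fin N) (Fin N) ℂ) * R with hW
  set k : ℝ := √(IsQuat.normSq (cmQuat e R g)) with hk
  -- polar form with unit part `1`: `Q = k • 1`
  have hQ : cmQuat e R g = (k : ℂ) • (1 : Matrix (Fin 2) (Fin 2) ℂ) := by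
    have hu : quatUnit (cmQuat e R g) = 1 := by
      have := congrArg (fun u : Matrix.specialUnitaryGroup (Fin 2) ℂ => (u : Matrix (Fin 2) (Fin 2) ℂ)) h
      simpa only [coe_cmUnit, OneMemClass.coe_one] using this
    have hpol := quatUnit_smul (isQuat_cmQuat e R g)
    rw [hu] at hpol
    exact hpol.symm
  rw [cmQuat_eq_quatOf] at hQ
  have h01 := congr_fun (congr_fun hQ 0) 1
  have h00 := congr_fun (congr_fun hQ 0) 0
  simp only [quatOf, Matrix.of_apply, Matrix.cons_val', Matrix.cons_val_zero, Matrix.cons_val_one,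
    Matrix.empty_val', Matrix.cons_val_fin_one, Matrix.smul_apply, Matrix.one_apply_eq, Matrix.one_apply_ne
    (show (0 : Fin 2) ≠ 1 by decide), smul_eq_mul, mul_one, mul_zero] at h01 h00
  refine ⟨sub_eq_zero.1 h01, ?_⟩
  have him := congrArg Complex.im h00
  simp only [Complex.add_im, Complex.conj_im, Complex.ofReal_im] at him
  linarith

/-- The embedding `φ = blockEmbSU e` is injective on the nose: `φ(A) = 1 → A = 1`. -/
theorem blockEmbSU_eq_one {A : Matrix.specialUnitaryGroup (Fin 2) ℂ} (h : blockEmbSU e A = 1) : A = 1 := by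
  have hM : blockEmb e (A : Matrix (Fin 2) (Fin 2) ℂ) = 1 := by
    have := congrArg (fun u : Matrix.specialUnitaryGroup (Fin N) ℂ => (u : Matrix (Fin N) (Fin N) ℂ)) h
    simpa only [coe_blockEmbSU, OneMemClass.coe_one] using this
  have hb := toBlocks₁₁_blockEmb_mul e (A : Matrix (Fin 2) (Fin 2) ℂ) (1 : Matrix (Fin N) (Fin N) ℂ)
  rw [hM, Matrix.one_mul, Matrix.submatrix_one_equiv, ← Matrix.fromBlocks_one, Matrix.toBlocks_fromBlocks₁₁,
    Matrix.mul_one] at hb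
  exact Subtype.ext hb.symm

/-- A link fixed by the cooling hit has unit part `ŝ = 1`. -/
theorem cmUnit_eq_one_of_cmCool_eq {g : Matrix.specialUnitaryGroup (Fin N) ℂ} (h : cmCool e R g = g) :
    cmUnit e R g = 1 := by
  have h1 : blockEmbSU e (cmUnit e R g)⁻¹ = 1 := by
    have h' : blockEmbSU e (cmUnit e R g)⁻¹ * g = 1 * g := by rwa [one_mul]
    exact mul_right_cancel h'
  have := blockEmbSU_eq_one e h1
  rwa [inv_eq_one] at this

/-- **If the cooling hits of a pair-covering family of frames all fix the link, then `P(gR) = 0`.**  The family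
covers the pairs when every `i < j` is the coordinate pair of one of its frames (the engine's lexicographic scan). -/
theorem suProj_eq_zero_of_cmCool_fixed [NeZero N] {frames : List (Fin N ≃ Fin 2 ⊕ m)}
    (hcover : ∀ i j : Fin N, i < j → ∃ f ∈ frames, pairOf f = (i, j)) {g : Matrix.specialUnitaryGroup (Fin N) ℂ}
    (hfix : ∀ f ∈ frames, cmCool f R g = g) : suProj ((g : Matrix (Fin N) (Fin N) ℂ) * R) = 0 := by
  have hpair : ∀ i j : Fin N, i < j →
      ((g : Matrix (Fin N) (Fin N) ℂ) * R) i j = conj (((g : Matrix (Fin N) (Fin N) ℂ) * R) j i) ∧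
        (((g : Matrix (Fin N) (Fin N) ℂ) * R) i i).im = (((g : Matrix (Fin N) (Fin N) ℂ) * R) j j).im := by
    intro i j hij
    obtain ⟨f, hf, hp⟩ := hcover i j hij
    have h := cmUnit_eq_one_entries f R (cmUnit_eq_one_of_cmCool_eq f R (hfix f hf))
    rw [hp] at h
    exact h
  refine suProj_eq_zero_of_pairs _ (fun i j hij => ?_) (fun i j => ?_)
  · rcases lt_or_gt_of_ne hij with hlt | hgt
    · exact (hpair i j hlt).1
    · rw [(hpair j i hgt).1, Complex.conj_conj]
  · rcases lt_trichotomy i j with hlt | heq | hgt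
    · exact (hpair i j hlt).2
    · rw [heq]
    · exact ((hpair j i hgt).2).symm

end OneLink

/-! ## §3 The lattice: cooling-fixed configurations are Wilson-flow stationary -/

section Lattice

variable {N d L : ℕ} [NeZero N] [NeZero L] {m : Type*} [Fintype m] [DecidableEq m]

omit [NeZero N] [NeZero L] in
/-- If the lattice hit at `(x, μ)` in frame `e` fixes `U`, the one-link hit fixes `U_{(x,μ)}`. -/
theorem cmCool_eq_of_cmLatCool_eq (e : Fin N ≃ Fin 2 ⊕ m) (x : Site d L) (μ : Fin d)
    {U : GaugeConfig d L (Matrix.specialUnitaryGroup (Fin N) ℂ)} (h : cmLatCool e x μ U = U) :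
    cmCool e (Scoring.stapleSum (suRep N) U x μ) (U (x, μ)) = U (x, μ) := by
  have := congr_fun h (x, μ)
  rwa [cmLatCool_apply_self] at this

omit [NeZero L] in
/-- **A configuration fixed by every cooling hit of a pair-covering frame family, at every link, has vanishing
Wilson-flow vector field**: `Z(U)_e = −P(Ω_e(U)) U_e = 0`. -/
theorem wilsonFlowVF_eq_zero_of_cmLatCool_fixed {frames : List (Fin N ≃ Fin 2 ⊕ m)}
    (hcover : ∀ i j : Fin N, i < j → ∃ f ∈ frames, pairOf f = (i, j))
    {U : GaugeConfig d L (Matrix.specialUnitaryGroup (Fin N) ℂ)}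
    (hfix : ∀ (x : Site d L) (μ : Fin d), ∀ f ∈ frames, cmLatCool f x μ U = U) (e : Edge d L) :
    wilsonFlowVF U e = 0 := by
  obtain ⟨x, μ⟩ := e
  have hP : suProj (plaquetteLoopSum U x μ) = 0 := by
    rw [Scoring.plaquetteLoopSum_eq_mul_stapleSum]
    exact suProj_eq_zero_of_cmCool_fixed (Scoring.stapleSum (suRep N) U x μ) hcover
      (fun f hf => cmCool_eq_of_cmLatCool_eq f x μ (hfix x μ f hf))
  rw [wilsonFlowVF_apply, hP, neg_zero, Matrix.zero_mul]

/-- **COOLING-FIXED CONFIGURATIONS ARE WILSON-FLOW STATIONARY**: if every Cabibbo–Marinari cooling hit (every link,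
every frame of a family whose pairs cover all `i < j`) fixes `U`, then `V_t(U) = U` for every real flow time `t`. -/
theorem wilsonFlow_eq_self_of_cmLatCool_fixed {frames : List (Fin N ≃ Fin 2 ⊕ m)}
    (hcover : ∀ i j : Fin N, i < j → ∃ f ∈ frames, pairOf f = (i, j))
    {U : GaugeConfig d L (Matrix.specialUnitaryGroup (Fin N) ℂ)}
    (hfix : ∀ (x : Site d L) (μ : Fin d), ∀ f ∈ frames, cmLatCool f x μ U = U) (t : ℝ) :
    wilsonFlow t U = U :=
  wilsonFlow_eq_self_of_wilsonFlowVF_eq_zero (wilsonFlowVF_eq_zero_of_cmLatCool_fixed hcover hfix) t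

end Lattice

/-! ## §4 Appendix (GEN-3, same seat): the engine's frame family covers the pairs — the hypothesis-free corollary

For `N ≥ 2` every pair `i < j` of `Fin N` is the coordinate pair of SOME frame `Fin N ≃ Fin 2 ⊕ Fin (N − 2)`
(row 9's `exists_frame_pairOf`), so "fixed by every cooling hit in every frame" already implies the
pair-covering hypothesis of §3: a configuration fixed by ALL Cabibbo–Marinari cooling hits is Wilson-flow
stationary, with no bookkeeping of the scan left to the reader. -/

section AllFrames

variable {N d L : ℕ} [NeZero N] [NeZero L]

omit [NeZero N] [NeZero L] in
/-- For `N ≥ 2` there is a (finite) frame family whose coordinate pairs cover every `i < j`. -/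
theorem exists_pairCovering_frames (h2 : 2 ≤ N) :
    ∃ frames : List (Fin N ≃ Fin 2 ⊕ Fin (N - 2)), ∀ i j : Fin N, i < j → ∃ f ∈ frames, pairOf f = (i, j) := by
  classical
  have h2' : 2 ≤ Fintype.card (Fin N) := by rwa [Fintype.card_fin]
  -- one frame per ordered pair `i ≠ j` (row 9's `exists_frame_pairOf`), listed over all pairs
  have hch : ∀ p : {p : Fin N × Fin N // p.1 ≠ p.2}, ∃ e : Fin N ≃ Fin 2 ⊕ Fin (Fintype.card (Fin N) - 2),
      pairOf e = (p.1.1, p.1.2) := fun p => exists_frame_pairOf h2' p.2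
  choose fr hfr using hch
  have hc : Fintype.card (Fin N) - 2 = N - 2 := by rw [Fintype.card_fin]
  refine ⟨(Finset.univ : Finset {p : Fin N × Fin N // p.1 ≠ p.2}).toList.map
    (fun p => (fr p).trans (Equiv.sumCongr (Equiv.refl (Fin 2)) (finCongr hc))), fun i j hij => ?_⟩
  refine ⟨(fr ⟨(i, j), ne_of_lt hij⟩).trans (Equiv.sumCongr (Equiv.refl (Fin 2)) (finCongr hc)), ?_, ?_⟩
  · exact List.mem_map.2 ⟨⟨(i, j), ne_of_lt hij⟩, Finset.mem_toList.2 (Finset.mem_univ _), rfl⟩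
  · have h := hfr ⟨(i, j), ne_of_lt hij⟩
    simp only [pairOf, Prod.mk.injEq] at h ⊢
    simp only [Equiv.symm_trans_apply, Equiv.sumCongr_symm, Equiv.sumCongr_apply, Equiv.refl_symm,
      Sum.map_inl, Equiv.refl_apply]
    exact h

/-- **A CONFIGURATION FIXED BY EVERY CABIBBO–MARINARI COOLING HIT IS WILSON-FLOW STATIONARY** (`N ≥ 2`, every
`d`, `L ≥ 1`): if `cmLatCool e x μ U = U` for every link `(x, μ)` and EVERY frame `e : Fin N ≃ Fin 2 ⊕ Fin (N − 2)`,
then `V_t(U) = U` for all real `t`. -/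
theorem wilsonFlow_eq_self_of_forall_cmLatCool_fixed (h2 : 2 ≤ N)
    {U : GaugeConfig d L (Matrix.specialUnitaryGroup (Fin N) ℂ)}
    (hfix : ∀ (x : Site d L) (μ : Fin d) (e : Fin N ≃ Fin 2 ⊕ Fin (N - 2)), cmLatCool e x μ U = U) (t : ℝ) :
    wilsonFlow t U = U := by
  obtain ⟨frames, hcover⟩ := exists_pairCovering_frames h2
  exact wilsonFlow_eq_self_of_cmLatCool_fixed hcover (fun x μ f _ => hfix x μ f) t

end AllFrames

end Summit.Ventures.LatticeQCDFlow.Exactness
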